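import Literature.MathematicalPhysics.QuantumLattice.DWaveSourcePhaseRotation
import HarnessLib

/-!
# Step (δ): the approximating (sourced) ground energies are bounded BELOW by the sourced energy at the
# base field minus `g · m_L(h₀ + 2gK_d)²` — concavity / Hellmann–Feynman sandwich + completing the square

Topic `Literature/MathematicalPhysics/QuantumLattice` (namespace = path). Cell `pub/hubbard-cq`, seat
`hubbard-cq-p1` (g3): step (δ) of transplant-1's DICTIONARY v4 §12 chain for the infinite-volume pair-LRO
ceiling `TIGroundStatePairLROCeiling` ((α) = `ApproximatingHamiltonianGroundEnergy.lean`, (γ) =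
`DWaveSourcePhaseRotation.lean`). Everything is PROVED; no definition, no named fact, zero compute.
Notation: `Δ_d = pairField dWaveFormFactor L`, `A_L(h) = dWaveSourceTorusTT' L t' U μ h = H^{tt'} − μN − h(Δ_d + Δ_d†)`,
`E_L(h) = E₀(A_L(h))`, `m_L(h) = dWaveSourceDensityTT' L t' U μ h` (`Re ω₀(Δ_d)/L²`),
`K_d = 2 Σ_{e ∈ {0} ∪ unitSteps} |f_d(e)/√2|` (the constant of `norm_pairField_le` / `dWaveSourceDensityTT'_le_const`:
`‖Δ_d‖ ≤ K_d L²`, `m_L ≤ K_d`).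

* `groundEnergy_dWaveSourceTorusTT'_sub_mul_density_le` — **(δ1) the sandwich at a shifted field**: for
  `0 ≤ u ≤ u_max`, `E_L(h₀) − 2u·L²·m_L(h₀ + u_max) ≤ E_L(h₀ + u)` (supergradient inequality
  `dWaveSourceDensityTT'_mul_le_groundEnergy_drop` at `(h₀ + u, h₀)` and monotonicity of `m_L`).
* `groundEnergy_dWaveSourceTorusTT'_div_sub_mul_sq_le_approx` — **(δ2) the lower bound of the approximating
  family**: for `h₀ ≥ 0`, `g > 0` and EVERY `c ∈ ℂ`,
  `E_L(h₀)/L² − g·m_L(h₀ + 2gK_d)² ≤ E₀(A_L(h₀) − (c̄U + cUᴴ))/L² + |c|²`, `U = √g·Δ_d`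
  ((γ): the complex source costs at most the real source `h₀ + √g|c|`; then (δ1) with `u_max = 2gK_d` and the
  square `(√g m − |c|)² ≥ 0` when `√g|c| ≤ 2gK_d`, the crude slope `m_L ≤ K_d` beyond).
  With (α) `groundEnergy_model_div_le_approx_add_sq` / `exists_groundEnergy_approx_add_sq_le_model` this is the
  `inf_c` side of the T = 0 approximating-Hamiltonian sandwich for `A_L(h₀) − (g/L²)Δ_d†Δ_d` (assembly with the
  (β) commutator constants = seat p3's file; not done here).

## References
* T. Koma, H. Tasaki, J. Stat. Phys. 76 (1994) 745–803, §1 (sourced ground energies, concavity in the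
  source). [cite: KomaTasaki1994, §1]
* R. B. Griffiths, Phys. Rev. 152 (1966) 240, §II (convexity / supergradient bounds of sourced free
  energies). [cite: Griffiths1966, §II]
* J.-B. Bru, W. de Siqueira Pedra, Mem. AMS 224 (2013) no. 1052, §2.1 (approximating Hamiltonians; the
  variational problem over `c`). [cite: BruPedra2013, §2.1]
-/

noncomputable section

open Matrix Complex Finset Filter Literature.Probability.LatticeModels
open scoped Matrix.Norms.L2Operator ComplexOrder

namespace Literature.MathematicalPhysics.QuantumLattice

section StepDelta

variable (L : ℕ) [NeZero L] (t' U μ : ℝ)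

/-- **(δ1) Sandwich at a shifted field**: for `0 ≤ u ≤ u_max`,
`E_L(h₀) − 2u·L²·m_L(h₀ + u_max) ≤ E_L(h₀ + u)` — the supergradient inequality of the concave `E_L` at
`h₀ + u` (`−2L²m_L(h₀+u) ∈ ∂E_L(h₀+u)`) and `m_L(h₀+u) ≤ m_L(h₀+u_max)`.
[cite: KomaTasaki1994, §1] [cite: Griffiths1966, §II] -/
theorem groundEnergy_dWaveSourceTorusTT'_sub_mul_density_le {h₀ u umax : ℝ} (hu : 0 ≤ u) (hle : u ≤ umax) :
    (dWaveSourceTorusTT' L t' U μ h₀).groundEnergy -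
        2 * u * (L : ℝ) ^ 2 * dWaveSourceDensityTT' L t' U μ (h₀ + umax) ≤
      (dWaveSourceTorusTT' L t' U μ (h₀ + u)).groundEnergy := by
  have h1 := dWaveSourceDensityTT'_mul_le_groundEnergy_drop (L := L) t' U μ (h₀ + u) h₀
  have h2 : dWaveSourceDensityTT' L t' U μ (h₀ + u) ≤ dWaveSourceDensityTT' L t' U μ (h₀ + umax) :=
    dWaveSourceDensityTT'_mono t' U μ (by linarith)
  have h3 : 2 * u * (L : ℝ) ^ 2 * dWaveSourceDensityTT' L t' U μ (h₀ + u) ≤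
      2 * u * (L : ℝ) ^ 2 * dWaveSourceDensityTT' L t' U μ (h₀ + umax) :=
    mul_le_mul_of_nonneg_left h2 (by positivity)
  nlinarith [h1, h3]

/-- **(δ1′) per-site form**: `E_L(h₀)/L² − 2u·m_L(h₀ + u_max) ≤ E_L(h₀ + u)/L²` for `0 ≤ u ≤ u_max`.
[cite: KomaTasaki1994, §1] -/
theorem groundEnergy_dWaveSourceTorusTT'_div_sub_mul_density_le {h₀ u umax : ℝ} (hu : 0 ≤ u)
    (hle : u ≤ umax) :
    (dWaveSourceTorusTT' L t' U μ h₀).groundEnergy / (L : ℝ) ^ 2 -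
        2 * u * dWaveSourceDensityTT' L t' U μ (h₀ + umax) ≤
      (dWaveSourceTorusTT' L t' U μ (h₀ + u)).groundEnergy / (L : ℝ) ^ 2 := by
  have hL : (0 : ℝ) < (L : ℝ) ^ 2 := by
    have : (0 : ℝ) < (L : ℝ) := by exact_mod_cast Nat.pos_of_ne_zero (NeZero.ne L)
    positivity
  have key := groundEnergy_dWaveSourceTorusTT'_sub_mul_density_le L t' U μ hu hle (h₀ := h₀)
  have h := div_le_div_of_nonneg_right key hL.le
  have e : ((dWaveSourceTorusTT' L t' U μ h₀).groundEnergy -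
      2 * u * (L : ℝ) ^ 2 * dWaveSourceDensityTT' L t' U μ (h₀ + umax)) / (L : ℝ) ^ 2 =
      (dWaveSourceTorusTT' L t' U μ h₀).groundEnergy / (L : ℝ) ^ 2 -
        2 * u * dWaveSourceDensityTT' L t' U μ (h₀ + umax) := by
    rw [sub_div, mul_right_comm, mul_div_assoc, div_self hL.ne', mul_one]
  rwa [e] at h

/-- The approximating source of the channel `U = √g·Δ_d` is a complex pair source of strength `z = √g·c`:
`c̄U + cUᴴ = z̄Δ_d + zΔ_d†`. [cite: BruPedra2013, §2.1] -/
theorem conj_smul_sqrt_smul_pairField_add (g : ℝ) (c : ℂ) :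
    starRingEnd ℂ c • (((Real.sqrt g : ℝ) : ℂ) • pairField dWaveFormFactor L) +
        c • (((Real.sqrt g : ℝ) : ℂ) • pairField dWaveFormFactor L)ᴴ =
      starRingEnd ℂ (((Real.sqrt g : ℝ) : ℂ) * c) • pairField dWaveFormFactor L +
        (((Real.sqrt g : ℝ) : ℂ) * c) • (pairField dWaveFormFactor L)ᴴ := by
  rw [conjTranspose_smul, map_mul, Complex.conj_ofReal, smul_smul, smul_smul, mul_comm (starRingEnd ℂ c)]
  congr 2
  rw [Complex.star_def, Complex.conj_ofReal, mul_comm]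

/-- **(δ2) LOWER BOUND OF THE APPROXIMATING FAMILY**: for `h₀ ≥ 0`, `g > 0` and every `c ∈ ℂ`,
`E_L(h₀)/L² − g·m_L(h₀ + 2gK_d)² ≤ E₀(A_L(h₀) − (c̄U + cUᴴ))/L² + |c|²` with `U = √g·Δ_d`,
`K_d = 2Σ_e|f_d(e)/√2|`. Route: (γ) `E_L(h₀ + √g|c|) ≤ E₀(A_L(h₀) − (c̄U + cUᴴ))`; if `√g|c| ≤ 2gK_d`, (δ1) with
`u_max = 2gK_d` and `|c|² − 2√g|c|m + g m² = (|c| − √g m)² ≥ 0`; otherwise (δ1) with `u_max = u`, the slope bound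
`m_L ≤ K_d` and `|c|(|c| − 2√gK_d) ≥ 0`. [cite: BruPedra2013, §2.1] [cite: KomaTasaki1994, §1] -/
theorem groundEnergy_dWaveSourceTorusTT'_div_sub_mul_sq_le_approx {h₀ g : ℝ} (hh₀ : 0 ≤ h₀) (hg : 0 < g)
    (c : ℂ) :
    (dWaveSourceTorusTT' L t' U μ h₀).groundEnergy / (L : ℝ) ^ 2 -
        g * dWaveSourceDensityTT' L t' U μ
          (h₀ + 2 * g * (2 * ∑ e ∈ insert (0 : Site 2) unitSteps, |dWaveFormFactor e / Real.sqrt 2|)) ^ 2 ≤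
      (dWaveSourceTorusTT' L t' U μ h₀ -
          (starRingEnd ℂ c • (((Real.sqrt g : ℝ) : ℂ) • pairField dWaveFormFactor L) +
            c • (((Real.sqrt g : ℝ) : ℂ) • pairField dWaveFormFactor L)ᴴ)).groundEnergy / (L : ℝ) ^ 2 +
        ‖c‖ ^ 2 := by
  set K : ℝ := 2 * ∑ e ∈ insert (0 : Site 2) unitSteps, |dWaveFormFactor e / Real.sqrt 2| with hK
  set m : ℝ := dWaveSourceDensityTT' L t' U μ (h₀ + 2 * g * K) with hm
  have hK0 : 0 ≤ K := by positivity
  have hsg : 0 < Real.sqrt g := Real.sqrt_pos.2 hg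
  have hsg2 : Real.sqrt g ^ 2 = g := Real.sq_sqrt hg.le
  have hm0 : 0 ≤ m := dWaveSourceDensityTT'_nonneg t' U μ (by positivity)
  -- (γ): the complex source costs at most the real source `h₀ + √g‖c‖`
  have hγ := groundEnergy_dWaveSourceTorusTT'_add_le_groundEnergy_sub_phaseSource L t' U μ hh₀
    (((Real.sqrt g : ℝ) : ℂ) * c)
  rw [← conj_smul_sqrt_smul_pairField_add L g c] at hγ
  have hz : ‖((Real.sqrt g : ℝ) : ℂ) * c‖ = Real.sqrt g * ‖c‖ := by
    rw [norm_mul, Complex.norm_real, Real.norm_of_nonneg hsg.le]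
  rw [hz] at hγ
  have hL : (0 : ℝ) < (L : ℝ) ^ 2 := by
    have : (0 : ℝ) < (L : ℝ) := by exact_mod_cast Nat.pos_of_ne_zero (NeZero.ne L)
    positivity
  have hγ' := div_le_div_of_nonneg_right hγ hL.le
  have hu0 : 0 ≤ Real.sqrt g * ‖c‖ := by positivity
  by_cases hcase : Real.sqrt g * ‖c‖ ≤ 2 * g * K
  · -- (δ1) with `u_max = 2gK`, then complete the square
    have hδ := groundEnergy_dWaveSourceTorusTT'_div_sub_mul_density_le L t' U μ hu0 hcase (h₀ := h₀)
    rw [← hm] at hδ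
    nlinarith [hδ, hγ', sq_nonneg (Real.sqrt g * m - ‖c‖), hsg2]
  · -- large sources: (δ1) with `u_max = u`, slope bound `m_L ≤ K`
    push Not at hcase
    have hδ := groundEnergy_dWaveSourceTorusTT'_div_sub_mul_density_le L t' U μ hu0 le_rfl (h₀ := h₀)
    have hMK : dWaveSourceDensityTT' L t' U μ (h₀ + Real.sqrt g * ‖c‖) ≤ K :=
      dWaveSourceDensityTT'_le_const L t' U μ _
    have h1 : 2 * (Real.sqrt g * ‖c‖) * dWaveSourceDensityTT' L t' U μ (h₀ + Real.sqrt g * ‖c‖) ≤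
        2 * (Real.sqrt g * ‖c‖) * K := mul_le_mul_of_nonneg_left hMK (by positivity)
    have hc : 2 * Real.sqrt g * K < ‖c‖ := by
      -- `√g‖c‖ > 2gK = 2√g·(√gK)` and `√g > 0`
      have : Real.sqrt g * (2 * Real.sqrt g * K) < Real.sqrt g * ‖c‖ := by nlinarith [hsg2]
      exact lt_of_mul_lt_mul_left this hsg.le
    have h2 : 0 ≤ ‖c‖ * (‖c‖ - 2 * Real.sqrt g * K) := mul_nonneg (norm_nonneg _) (by linarith)
    nlinarith [hδ, hγ', h1, h2, sq_nonneg m, hm0, hg]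

end StepDelta

end Literature.MathematicalPhysics.QuantumLattice

end
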